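import Summits.HodgeConjecture.HodgeConjecture.Theses.HeckePrymWeil
import Summits.HodgeConjecture.HodgeConjecture.Theorems.HeckePrymWeilProductDescentOfDeRham
import Literature.AlgebraicGeometry.Motives.AimedSplitProduct
import Literature.AlgebraicGeometry.Motives.AbelianVarietyProductDimProofs
import Literature.NumberTheory.Transcendental.DeRhamTheoremMultiplicative

/-!
# `AimedDescending` (stmt-HodgeConjecture-14643) · XIII · the lever modulo the aiming lemma alone

Route `HeckePrymWeil`, support item `AimedDescending` (the LEVER): for a prime `p ≡ 3 (4)`, `p ≥ 7`
and `n ≥ 1`, the SPLIT rung predicate in dimension `2n + 2` (Hodge–Weil classes algebraic on every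
`ℚ(√-p)`-Weil `(2n+2)`-fold which is of hyperbolic Weil type for the `K`-symmetrised hyperplane
class of some projective embedding) implies the rung predicate `HWA(p, n)` for ALL discriminants
(Schoen, Compositio Math. 114 (1998) §10; Koike 2004 Thm. 2.1; Markman, arXiv:2509.23403 §11.5
Step 2; van Geemen, LNM 1594, 5.2–5.4; Landherr 1936).

File I (`HeckePrymWeilAimedDescending`, `aimedDescending_of_partner_of_descent`) proved
`(P) ∧ (D) ⟹ AimedDescending` with BOTH printed inputs as hypotheses: (P) the AIMED partner (a Weil
surface `(B, ψ)` making `A × B` hyperbolic for a `K`-symmetrised hyperplane class) and (D) the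
pointwise product descent for EVERY Weil surface partner. Since then two things landed in the tree:

* de Rham's theorem in multiplicative form is a THEOREM
  (`Literature.NumberTheory.Transcendental.exists_deRhamIsoFamily_holds`, 2026-08-16), so Schoen's
  transfer `productDescentAt_of_deRham` (`Theorems/HeckePrymWeilProductDescentOfDeRham`) is
  unconditional for a GIVEN partner carrying a descent datum;
* the aiming half of the product trick is the NAMED FACT
  `Literature.AlgebraicGeometry.Motives.exists_cmWeilSurface_aimedSplitProduct_of_ne_one_of_ne_three`
  (`Literature/AlgebraicGeometry/Motives/AimedSplitProduct`): for `d ∉ {1, 3}` ONE Weil surface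
  `(B, ψ)` with a DESCENT PAIR (`b₊ ∈ Eig((𝟙+ψ)^*, (1+i√d)²)`, `b₋ ∈ Eig((𝟙+ψ)^*, (1-i√d)²)`,
  `b₊ + b₋` rational of type `(1,1)`, `η` algebraic with `b± ⌣ η ≠ 0`) such that for every Weil-type
  `(A, φ)` of every even dimension `A × B` is hyperbolic for the `K`-symmetrised hyperplane class of
  some projective embedding — exactly the typing of the route's split rung hypothesis.

This file composes them:

* `productDescentAt_of_descentPair` — **(D) in the descent-pair typing, unconditionally**: for
  `p ≥ 4`, `n ≥ 1`, `(A, φ)` of dimension `2n`, a surface `(B, ψ)` with a descent pair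
  `(b₊, b₋, η)` as above, if the rational `(n+1, n+1)` classes of the Weil plane of
  `(A × B, φ × ψ)` are algebraic then so is every rational `(n, n)` class of the Weil plane of
  `(A, φ)` (Schoen's transfer along the real Gysin map `complexGysin`: the proof of
  `productDescentAt_of_deRham` with the non-vanishing `b± ⌣ η ≠ 0` GIVEN instead of derived from a
  rational partner `t` with `b ⌣ t ≠ 0`; neither `φ² = -p` nor `ψ² = -p` is used);
* `aimedDescending_of_aimedSplitProduct` — **the aiming lemma ALONE implies `AimedDescending`**:
  given `(A, φ)` of dimension `2n` and a rational `(n, n)` Weil class `c ≠ 0` (the case `c = 0` is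
  trivial), the fact at `d = p` (`p ≥ 7`, so `p ∉ {1, 3}`) supplies `(B, ψ)`, its descent pair and
  an embedding `e` of `A × B` with `(A × B, φ × ψ)` hyperbolic in half-dimension `n + 1`;
  `dim (A × B) = 2(n+1)` (`dim_prod`) and `(φ × ψ)² = -p` (`prodLift_comp_self_eq_neg_zsmul`), so
  the split rung hypothesis applies to the product and `productDescentAt_of_descentPair` descends.

So the item is CLOSED MODULO the single named fact
`Motives.exists_cmWeilSurface_aimedSplitProduct_of_ne_one_of_ne_three` (van Geemen 5.2 (3), 5.3,
5.4 (5.4.1); Markman §11.5 Step 2): `theorem aimedDescending_proof : AimedDescending :=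
aimedDescending_of_aimedSplitProduct ‹_›_holds` the day it is discharged. What that discharge
needs is recorded in the fact's module docstring ("Why it is not proved here": the CM Weil surface
`E₀ × E₀` with `K` acting through `(ι, ῑ)` as scheme endomorphisms, `H^• = ⋀^• H¹` with a Riemann
form and Hodge–Riemann in degree one for an arbitrary `A`, the hyperplane class of a weighted
Segre embedding on `complexBetti`); its arithmetic core and carrier glue are files III–XII of this
item (`aimingArithmetic`, `isHyperbolicWeilType_prod_of_rationalModels`,
`exists_isotropic_blockVectors'`).
-/

noncomputable section

-- every declaration of this problem lives in `Summit.HodgeConjecture.HodgeConjecture.…`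
set_option linter.dupNamespace false

open scoped Manifold
open CategoryTheory MonoidalCategory CartesianMonoidalCategory
open Literature.AlgebraicGeometry Literature.AlgebraicGeometry.HodgeTheory
open Literature.AlgebraicTopology.SingularHomology
open Summit.HodgeConjecture.HodgeConjecture.Theses.HeckePrymWeil

namespace Summit.HodgeConjecture.HodgeConjecture.Theorems

/-- **Schoen's product step, downward half, for ONE Weil pair and a GIVEN partner with a descent
pair — unconditionally.** Let `p ≥ 4`, `n ≥ 1`, `(A, φ)` an abelian `2n`-fold and `(B, ψ)` an
abelian surface with endomorphisms, and `(b₊, b₋, η)` a DESCENT PAIR on `B`: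
`b₊ ∈ Eig((𝟙+ψ)^*, (1+i√p)²)`, `b₋ ∈ Eig((𝟙+ψ)^*, (1-i√p)²)` in `H²(B(ℂ); ℂ)`, `b₊ + b₋` rational
of Hodge type `(1,1)`, `η ∈ N¹H²(B(ℂ); ℂ)` algebraic with `b₊ ⌣ η ≠ 0` and `b₋ ⌣ η ≠ 0` in `H⁴`
(Schoen 1998 §10: "`W_{A'}` is generated by cohomology classes of divisors",
"`ω_{5,σ₁} ∧ ω_{6,σ₁} ∧ ω_{5,σ₂} ∧ ω_{6,σ₂}` is a basis for `H⁴(A'; ℂ)`"). If every rational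
`(n+1, n+1)` class of `A × B` in the Weil plane of `(𝟙 + φ × ψ)^*` is algebraic, then every rational
`(n, n)` class `c` of `A` in the Weil plane of `(𝟙 + φ)^*` is algebraic. Proof (Schoen §10 /
Markman arXiv:2509.23403 §11.5 Step 2 on the tree's carriers, as in `productDescentAt_of_deRham`):
write `c = c₊ + c₋`; `pr_A^* c± ⌣ pr_B^* b±` are the `(𝟙 + φ×ψ)^*`-eigencomponents of the rational
`(n+1, n+1)` class `pr_A^*c ⌣ pr_B^*(b₊ + b₋)` (its Hodge type by de Rham's theorem in
multiplicative form, `exists_deRhamIsoFamily_holds`, through `cupPreservesHodgeType_of_nonempty_hodgeModel`),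
hence algebraic (`weilEigencomponents_mem_algebraicClasses_of_rung`); cup with the algebraic
`pr_B^* η` and push forward along `pr_A`: `pr_{A*}((pr_A^*c± ⌣ pr_B^*b±) ⌣ pr_B^*η) = c± ⌣ pr_{A*}pr_B^*(b± ⌣ η)`
with `pr_{A*}pr_B^*(b± ⌣ η) ≠ 0` (`complexGysin_fst_map_snd_ne_zero`), so `c±` and `c` are algebraic
(`mem_algebraicClasses_of_complexGysin_fst_cupProduct`). Neither `φ² = -p` nor `ψ² = -p` nor the
primality of `p` is used, only the separation `(1+i√p)ᵏ ≠ (1-i√p)ᵏ` (`k ≥ 1`, `p ≥ 4`).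
[cite: Schoen1998HodgeWeilAddendum, §10 (Proposition and proof, pp. 332–333)]
[cite: Markman2025SurveySecant, §11.5 Step 2] -/
theorem productDescentAt_of_descentPair
    {p : ℕ} (hp4 : 4 ≤ p) {n : ℕ} (hn : 1 ≤ n) {A : Motives.AbelianVariety ℂ} (φ : A ⟶ A)
    (hAdim : A.dim = 2 * n) {B : Motives.AbelianVariety ℂ} (ψ : B ⟶ B) (hBdim : B.dim = 2)
    {bp bm η : complexBetti B.X 2}
    (hbp : bp ∈ Module.End.eigenspace (complexBetti.map (𝟙 B + ψ).hom.hom.hom 2).hom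
          ((1 + Complex.I * (Real.sqrt (p : ℝ) : ℂ)) ^ 2))
    (hbm : bm ∈ Module.End.eigenspace (complexBetti.map (𝟙 B + ψ).hom.hom.hom 2).hom
          ((1 - Complex.I * (Real.sqrt (p : ℝ) : ℂ)) ^ 2))
    (hbr : IsRationalClass (bp + bm)) (hbH : IsOfHodgeType 2 B.X 2 1 1 (bp + bm))
    (hη : η ∈ algebraicClasses B.X 1)
    (hpη : cupProduct (show 2 + 2 = 4 from rfl) bp η ≠ 0)
    (hmη : cupProduct (show 2 + 2 = 4 from rfl) bm η ≠ 0)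
    (halgAB : ∀ c : complexBetti (A.prod B).X (2 * (n + 1)), IsRationalClass c →
      IsOfHodgeType (2 * (n + 1)) (A.prod B).X (2 * (n + 1)) (n + 1) (n + 1) c →
      c ∈ Module.End.eigenspace (complexBetti.map (𝟙 (A.prod B) +
              Motives.AbelianVariety.prodLift (Motives.AbelianVariety.fst A B ≫ φ)
                (Motives.AbelianVariety.snd A B ≫ ψ)).hom.hom.hom (2 * (n + 1))).hom
            ((1 + Complex.I * (Real.sqrt (p : ℝ) : ℂ)) ^ (2 * (n + 1))) ⊔
          Module.End.eigenspace (complexBetti.map (𝟙 (A.prod B) +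
              Motives.AbelianVariety.prodLift (Motives.AbelianVariety.fst A B ≫ φ)
                (Motives.AbelianVariety.snd A B ≫ ψ)).hom.hom.hom (2 * (n + 1))).hom
            ((1 - Complex.I * (Real.sqrt (p : ℝ) : ℂ)) ^ (2 * (n + 1))) →
      c ∈ algebraicClasses (A.prod B).X (n + 1))
    {c : complexBetti A.X (2 * n)} (hc : IsRationalClass c)
    (hcH : IsOfHodgeType (2 * n) A.X (2 * n) n n c)
    (hcW : c ∈ Module.End.eigenspace (complexBetti.map (𝟙 A + φ).hom.hom.hom (2 * n)).hom
          ((1 + Complex.I * (Real.sqrt (p : ℝ) : ℂ)) ^ (2 * n)) ⊔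
        Module.End.eigenspace (complexBetti.map (𝟙 A + φ).hom.hom.hom (2 * n)).hom
          ((1 - Complex.I * (Real.sqrt (p : ℝ) : ℂ)) ^ (2 * n))) :
    c ∈ algebraicClasses A.X n := by
  -- smoothness witnesses and the orientation family
  have hA : Motives.IsSmoothProjective (2 * n) A.X := isSmoothProjective_of_dim_eq hAdim
  have hB : Motives.IsSmoothProjective (2 * 1) B.X := isSmoothProjective_of_dim_eq hBdim
  have hAB : Motives.IsSmoothProjective (2 * (n + 1)) (A.prod B).X :=
    isSmoothProjective_prod_two_mul hA hB
  have hABt : Motives.IsSmoothProjective (2 * n + 2 * 1) (A.prod B).X :=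
    Motives.IsSmoothProjective.tensor_holds hA hB
  let μ : OrientationFamily := fun _ _ h ↦ Classical.choice (Motives.ComplexPoints.isOrientableOver ℂ h)
  -- `c = c₊ + c₋`
  obtain ⟨cp, hcp, cm, hcm, rfl⟩ := Submodule.mem_sup.1 hcW
  rw [Module.End.mem_eigenspace_iff] at hcp hcm
  -- the descent pair, read in degree `2 * 1`
  have hbp' : complexBetti.map (𝟙 B + ψ).hom.hom.hom (2 * 1) bp =
      (1 + Complex.I * (Real.sqrt (p : ℝ) : ℂ)) ^ (2 * 1) • bp :=
    Module.End.mem_eigenspace_iff.1 hbp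
  have hbm' : complexBetti.map (𝟙 B + ψ).hom.hom.hom (2 * 1) bm =
      (1 - Complex.I * (Real.sqrt (p : ℝ) : ℂ)) ^ (2 * 1) • bm :=
    Module.End.mem_eigenspace_iff.1 hbm
  have hbH' : IsOfHodgeType (2 * 1) B.X (2 * 1) 1 1 (bp + bm) := hbH
  -- the compatible endomorphism `Φ = φ × ψ`
  set Φ : A.prod B ⟶ A.prod B := Motives.AbelianVariety.prodLift (Motives.AbelianVariety.fst A B ≫ φ)
    (Motives.AbelianVariety.snd A B ≫ ψ) with hΦ
  have h₁ : Φ ≫ Motives.AbelianVariety.fst A B = Motives.AbelianVariety.fst A B ≫ φ :=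
    Motives.AbelianVariety.prodLift_fst _ _
  have h₂ : Φ ≫ Motives.AbelianVariety.snd A B = Motives.AbelianVariety.snd A B ≫ ψ :=
    Motives.AbelianVariety.prodLift_snd _ _
  -- Hodge type `(n+1, n+1)` of `pr_A^* c ∪ pr_B^* b` (multiplicative de Rham theorem)
  have hI := hodgePQ_independent_of_hodgeModel_holds
  have hfst : PreservesHodgeType (2 * n + 2 * 1) (2 * n) (Motives.AbelianVariety.fst A B).hom.hom.hom :=
    preservesHodgeType_of_nonempty_hodgeModel hI nonempty_hodgeModel_holds hABt hA _
  have hsnd : PreservesHodgeType (2 * n + 2 * 1) (2 * 1) (Motives.AbelianVariety.snd A B).hom.hom.hom :=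
    preservesHodgeType_of_nonempty_hodgeModel hI nonempty_hodgeModel_holds hABt hB _
  have hcupH : CupPreservesHodgeType (2 * n + 2 * 1) (A.prod B).X :=
    cupPreservesHodgeType_of_nonempty_hodgeModel hI nonempty_hodgeModel_holds
      (fun E _ _ _ => Literature.NumberTheory.Transcendental.exists_deRhamIsoFamily_holds E) hABt
  have h : 2 * n + 2 * 1 = 2 * (n + 1) := by ring
  have hH : IsOfHodgeType (2 * (n + 1)) (A.prod B).X (2 * (n + 1)) (n + 1) (n + 1)
      (cupProduct h (complexBetti.map (Motives.AbelianVariety.fst A B).hom.hom.hom (2 * n) (cp + cm))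
        (complexBetti.map (Motives.AbelianVariety.snd A B).hom.hom.hom (2 * 1) (bp + bm))) :=
    isOfHodgeType_cupProduct_map_fst_map_snd h hfst hsnd hcupH hcH hbH'
  -- upward half: `pr_A^* c± ∪ pr_B^* b±` are algebraic on `A × B`
  obtain ⟨hP, hMm⟩ := weilEigencomponents_mem_algebraicClasses_of_rung h₁ h₂ hp4 hn h hAB halgAB
    hcp hcm hbp' hbm' hc hbr hH
  -- `pr_B^* η` is algebraic on `A × B`, hence so are `(pr_A^* c± ∪ pr_B^* b±) ∪ pr_B^* η`
  have hη' : complexBetti.map (Motives.AbelianVariety.snd A B).hom.hom.hom (2 * 1) η ∈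
      algebraicClasses (A.prod B).X 1 :=
    map_snd_mem_supportedClasses hA hB hη
  have halgp := AbelianVariety.cupProduct_mem_algebraicClasses_one (A.prod B) hP hη'
  have halgm := AbelianVariety.cupProduct_mem_algebraicClasses_one (A.prod B) hMm hη'
  -- the fibre integrals `pr_{A*} pr_B^*(b± ∪ η) ≠ 0`
  have hjj' : 2 * 1 + 2 * 1 = 2 * (2 * 1) := rfl
  have hpη' : cupProduct hjj' bp η ≠ 0 := hpη
  have hmη' : cupProduct hjj' bm η ≠ 0 := hmη
  have hnep := complexGysin_fst_map_snd_ne_zero μ hA hB hpη'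
  have hnem := complexGysin_fst_map_snd_ne_zero μ hA hB hmη'
  -- Schoen's transfer, component by component
  refine Submodule.add_mem _ ?_ ?_
  · exact mem_algebraicClasses_of_complexGysin_fst_cupProduct μ hA hB (l := n) (j := 2 * 1)
      (j' := 2 * 1) (s := 2 * (n + 1)) h hjj' hnep halgp
  · exact mem_algebraicClasses_of_complexGysin_fst_cupProduct μ hA hB (l := n) (j := 2 * 1)
      (j' := 2 * 1) (s := 2 * (n + 1)) h hjj' hnem halgm

/-- **The aiming lemma of the product trick ALONE implies `AimedDescending`** (route
`HeckePrymWeil`, item stmt-HodgeConjecture-14643, closed modulo the named fact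
`Motives.exists_cmWeilSurface_aimedSplitProduct_of_ne_one_of_ne_three`). For a prime `p ≡ 3 (4)`,
`p ≥ 7`, `n ≥ 1`, the split rung hypothesis in dimension `2(n+1)`, `(A, φ)` of dimension `2n` with
`φ ≫ φ = -p` and a rational `(n, n)` class `c` of its Weil plane: if `c = 0` it is algebraic;
otherwise `c` witnesses Weil type and the fact at `d = p` (`p ∉ {1, 3}`) gives the CM Weil surface
`(B, ψ)` (`dim B = 2`, `ψ ≫ ψ = -p`) with its descent pair `(b₊, b₋, η)` and a projective
embedding `e` of `A × B` with a rational `a ≠ 0` making `(A × B, φ × ψ)` hyperbolic in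
half-dimension `n + 1` for the `K`-symmetrised hyperplane class `p·e^*a + (φ×ψ)^*e^*a`; as
`dim (A × B) = 2(n+1)` (`dim_prod`) and `(φ × ψ)² = -p` (`prodLift_comp_self_eq_neg_zsmul`), the
split rung hypothesis makes every rational `(n+1, n+1)` Weil class of `(A × B, φ × ψ)` algebraic, and
`productDescentAt_of_descentPair` returns `c` algebraic (Schoen 1998 §10; Markman arXiv:2509.23403
§11.5 Step 2, printed for `6 → 4`; Koike 2004 Thm. 2.1). [cite: Markman2025SurveySecant, §11.5 Step 2]
[cite: Schoen1998HodgeWeilAddendum, §10 (Proposition and proof)]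
[cite: vanGeemen1994HodgeAV, Lemma 5.2 (3), 5.3 and 5.4 (5.4.1)] -/
theorem aimedDescending_of_aimedSplitProduct
    (hX : Motives.exists_cmWeilSurface_aimedSplitProduct_of_ne_one_of_ne_three) :
    AimedDescending := by
  intro p hp hp4 hp7 n hn hSplit A φ hA hφ c hrat hH hW
  by_cases hc : c = 0
  · rw [hc]
    exact Submodule.zero_mem _
  obtain ⟨B, ψ, hB, hψ, ⟨bp, bm, η, hbp, hbm, hbr, hbH, hη, hpη, hmη⟩, hAim⟩ :=
    hX p hp.pos (by omega) (by omega)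
  obtain ⟨e, a, ha, ha0, hhyp⟩ := hAim n A φ hA hφ ⟨c, hc, hrat, hH, hW⟩
  have hdim : (A.prod B).dim = 2 * (n + 1) := by
    rw [Motives.AbelianVariety.dim_prod, hA, hB]
    ring
  exact productDescentAt_of_descentPair (by omega) hn φ hA ψ hB hbp hbm hbr hbH hη hpη hmη
    (hSplit (n + 1) rfl (A.prod B) _ hdim (prodLift_comp_self_eq_neg_zsmul hφ hψ) e a ha ha0 hhyp)
    hrat hH hW

end Summit.HodgeConjecture.HodgeConjecture.Theorems

end
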